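import Summits.AtomisticToContinuum.BoseEinsteinCondensation.Theorems.BECGroundStateSOSPeriodicIRBoundTwoSectorReduction
import Summits.AtomisticToContinuum.BoseEinsteinCondensation.Theorems.BECGroundStateSOSPeriodicIRBoundDifficultyFloor
import Summits.AtomisticToContinuum.BoseEinsteinCondensation.Theorems.BECGroundStateSOSPeriodicIRBoundOfClassUniform
import Summits.AtomisticToContinuum.BoseEinsteinCondensation.Theorems.PeriodicIRBound.Negative.GroundOccupation
import Summits.AtomisticToContinuum.BoseEinsteinCondensation.Theorems.PeriodicIRBound.Negative.HardCoreScope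
import Literature.MathematicalPhysics.QuantumManyBody.CondensationOptimalRateGP
import Literature.Barriers.AtomisticToContinuum.KineticGapLengthScales
import HarnessLib

/-!
# Strategist sketch for crux `PeriodicIRBound` (stmt-AtomisticToContinuum-3972) — the four language switches, typed

Companion of `STRATEGY-CENSUS.md` (crux-strategist seat s1, 2026-08-17). Nothing here is a new line or a new item:
§T types the SOLVED SIBLING's version of exactly this step (Gross–Pitaevskii window, Boccato–Brennecke–Cenatiempo–Schlein
optimal rate) and proves it from the vendored fact; §S types the strengthenings considered; §D types the candidate splits and
proves their glue AND their difficulty floors from landed theorems; §N is the negation normal form. `sorry`-free.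
-/

noncomputable section

open MeasureTheory Filter
open scoped ENNReal NNReal BigOperators

namespace Summit.AtomisticToContinuum.BoseEinsteinCondensation.Cruxes.PeriodicIRBound.Strategist

open Literature.MathematicalPhysics.QuantumManyBody.BoseGas
open Summit.AtomisticToContinuum.BoseEinsteinCondensation.Theses.BECGroundStateSOS (PeriodicIRBound)
open Summit.AtomisticToContinuum.BoseEinsteinCondensation.Theses.BECTwoSectorGD (GaussianDomination)
open Summit.AtomisticToContinuum.BoseEinsteinCondensation.Theses.BECSectorPoincareTwoScale
  (EnergyConvexityWindow LandauSectorBound)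
open Summit.AtomisticToContinuum.BoseEinsteinCondensation.Theorems.PeriodicIRBound.Negative
  (IRBoundFor NearMin InWindow IRIneq groundOccupation periodicIRBound_iff periodicIRBound_iff_split)
open Summit.AtomisticToContinuum.BoseEinsteinCondensation.Cruxes.PeriodicIRBound.TwoSectorGdTransfer
  (NonIntegrableHalf stub_periodicIRBoundOfPooled stub_integrableHalfOfPooled)
open Summit.AtomisticToContinuum.BoseEinsteinCondensation.Cruxes.GDTransfer.DysonDressedWitness (PeriodicBECFor)
open Summit.AtomisticToContinuum.BoseEinsteinCondensation.Cruxes.PeriodicIRBound.HardcoreMonotoneClassUniformity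
  (stub_reductionToClassUniformOne stub_floorOfClassUniformOne)
open Summit.AtomisticToContinuum.BoseEinsteinCondensation.Theorems.LandauToPeriodicBEC (periodicBEC_of_irBoundFor)

/-! ## §T TRANSFER — the solved sibling's version of exactly this step

In the Gross–Pitaevskii window (unit torus, `V_N = N²V(N·)`, scattering length `𝔞₀/N`) the crux's window
`‖k‖ ≤ κ√ρ L` contains `O(1)` modes and the `1/‖k‖` law for `δ`-near-minimisers is a COROLLARY of the optimal-rate
condensation `N - ⟨Ψ,n₀Ψ⟩ ≤ C(K+1)` [BoccatoEtAl2019, Thm 1.1] by Parseval (`∑_p n_p = N`). The proof of that input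
(ibid. Prop. 6.1: `𝒢_{N,ℓ} - 4π𝔞₀N ≥ c𝒩₊ - C`) is coercivity from the kinetic gap `4π²` of the unit torus against an
interaction `8π𝔞₀` per particle of the same order — the energy-window class that `KineticGapLengthScales` (LSSY2005
Thm 5.1; Fournais2020 Thm 1.2; Junge2026 Cor. 6) stops at `L ≲ (ρa)^{-1/2}(ρa³)^{-η}`, short of `L_N = (N/ρ)^{1/3}`. -/

/-- **T1 (typed): the GP-window analogue of the crux.** -/
def GPScaleIRBound : Prop :=
  ∀ (V : ℝ → ℝ≥0∞), Measurable V → (∫⁻ x : Space, V ‖x‖ ^ 3) ≠ ⊤ →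
    (∃ R₀ : ℝ, ∀ r, R₀ < r → V r = 0) →
    ∀ κ : ℝ, 0 < κ → ∃ (C : ℝ) (N₀ : ℕ), 0 < C ∧ ∀ N : ℕ, N₀ ≤ N → ∀ K : ℝ, 0 < K →
      ∀ Ψ : PeriodicTrialState N 1,
        periodicEnergy (fun r => (N : ℝ≥0∞) ^ 2 * V ((N : ℝ) * r)) Ψ ≤
            periodicGroundStateEnergy (fun r => (N : ℝ≥0∞) ^ 2 * V ((N : ℝ) * r)) N 1 +
              ENNReal.ofReal K →
        ∀ k : Fin 3 → ℤ, k ≠ 0 → ‖(fun j => (k j : ℝ))‖ ≤ κ →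
          cellOccupation N 1 (planeWaveMode 1 k) Ψ.ψ ≤
            ENNReal.ofReal (C * (K + 1) / ‖(fun j => (k j : ℝ))‖)

/-- `k ≠ 0 ⇒ 0 < ‖k‖` for the real image of an integer vector. [folklore] -/
private theorem norm_intVec_pos {k : Fin 3 → ℤ} (hk : k ≠ 0) : 0 < ‖(fun j => (k j : ℝ))‖ := by
  rw [norm_pos_iff]
  intro h
  apply hk
  funext j
  have := congr_fun h j
  simpa using this

/-- Parseval: a non-zero mode and the constant mode together carry at most `N` particles. [folklore] -/
private theorem occ_add_condensate_le {N : ℕ} (Ψ : PeriodicTrialState N 1) {k : Fin 3 → ℤ} (hk : k ≠ 0) :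
    cellOccupation N 1 (planeWaveMode 1 k) Ψ.ψ + condensateOccupation N 1 Ψ.ψ ≤ N := by
  rw [← cellOccupation_planeWaveMode_zero, ← Ψ.tsum_cellOccupation_planeWaveMode one_pos]
  calc cellOccupation N 1 (planeWaveMode 1 k) Ψ.ψ + cellOccupation N 1 (planeWaveMode 1 0) Ψ.ψ
      = ∑ p ∈ ({k, 0} : Finset (Fin 3 → ℤ)), cellOccupation N 1 (planeWaveMode 1 p) Ψ.ψ := by
        rw [Finset.sum_pair hk]
    _ ≤ ∑' p : Fin 3 → ℤ, cellOccupation N 1 (planeWaveMode 1 p) Ψ.ψ := ENNReal.sum_le_tsum _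

/-- **T1 is a corollary of the vendored GP-window fact** (so the sibling's version of this step is SOLVED in print):
BBCS optimal rate + Parseval. [cite: BoccatoEtAl2019, Thm 1.1] -/
theorem gpScaleIRBound_of_optimalRate (h : BoccatoEtAl2019_optimalRate_GP) : GPScaleIRBound := by
  intro V hV hL3 hR κ hκ
  obtain ⟨C, N₀, hN⟩ := h V hV hL3 hR
  -- WLOG the constant is ≥ 1
  set C₁ : ℝ := max C 1 with hC₁
  have hC₁pos : 0 < C₁ := lt_of_lt_of_le one_pos (le_max_right _ _)
  have hCC₁ : C ≤ C₁ := le_max_left _ _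
  refine ⟨C₁ * (C₁ + 1) * κ, N₀, by positivity, fun N hN₀ K hK Ψ hΨ k hk hkκ => ?_⟩
  have hN' := hN N hN₀
  simp only at hN'
  obtain ⟨hEup, -, hdep⟩ := hN'
  set a : ℝ := (scatteringLength V).toReal with ha
  have ha0 : 0 ≤ a := ENNReal.toReal_nonneg
  have hK' : 0 < C₁ + K := by positivity
  -- the near-minimiser has energy ≤ 4π a N + (C₁ + K)
  have hbase : 0 ≤ 4 * Real.pi * a * N + C₁ := by
    have : 0 ≤ 4 * Real.pi * a * N := by positivity
    linarith
  have hΨ' : periodicEnergy (fun r => (N : ℝ≥0∞) ^ 2 * V ((N : ℝ) * r)) Ψ ≤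
      ENNReal.ofReal (4 * Real.pi * a * N + (C₁ + K)) := by
    calc periodicEnergy (fun r => (N : ℝ≥0∞) ^ 2 * V ((N : ℝ) * r)) Ψ
        ≤ periodicGroundStateEnergy (fun r => (N : ℝ≥0∞) ^ 2 * V ((N : ℝ) * r)) N 1 +
            ENNReal.ofReal K := hΨ
      _ ≤ ENNReal.ofReal (4 * Real.pi * a * N + C) + ENNReal.ofReal K := by gcongr
      _ ≤ ENNReal.ofReal (4 * Real.pi * a * N + C₁) + ENNReal.ofReal K := by gcongr
      _ = ENNReal.ofReal (4 * Real.pi * a * N + (C₁ + K)) := by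
          rw [← ENNReal.ofReal_add hbase hK.le]; ring_nf
  -- optimal-rate depletion bound
  have hd := hdep (C₁ + K) hK' Ψ hΨ'
  -- Parseval: n_k ≤ N - n₀ ≤ C (C₁ + K + 1)
  have hsum := occ_add_condensate_le Ψ hk
  have hn0top : condensateOccupation N 1 Ψ.ψ ≠ ⊤ :=
    ne_top_of_le_ne_top (ENNReal.natCast_ne_top N) (le_trans le_add_self hsum)
  have hocc : cellOccupation N 1 (planeWaveMode 1 k) Ψ.ψ ≤ ENNReal.ofReal (C * (C₁ + K + 1)) := by
    have h1 : condensateOccupation N 1 Ψ.ψ + cellOccupation N 1 (planeWaveMode 1 k) Ψ.ψ ≤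
        condensateOccupation N 1 Ψ.ψ + ENNReal.ofReal (C * (C₁ + K + 1)) := by
      calc condensateOccupation N 1 Ψ.ψ + cellOccupation N 1 (planeWaveMode 1 k) Ψ.ψ
          = cellOccupation N 1 (planeWaveMode 1 k) Ψ.ψ + condensateOccupation N 1 Ψ.ψ := add_comm _ _
        _ ≤ N := hsum
        _ ≤ condensateOccupation N 1 Ψ.ψ + ENNReal.ofReal (C * (C₁ + K + 1)) := hd
    exact (ENNReal.add_le_add_iff_left hn0top).1 h1
  refine hocc.trans (ENNReal.ofReal_le_ofReal ?_)
  -- real arithmetic: C (C₁+K+1) ≤ C₁ (C₁+1)(K+1) · κ/‖k‖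
  have hkpos : 0 < ‖(fun j => (k j : ℝ))‖ := norm_intVec_pos hk
  have hratio : 1 ≤ κ / ‖(fun j => (k j : ℝ))‖ := by
    rw [le_div_iff₀ hkpos, one_mul]; exact hkκ
  have h2 : C * (C₁ + K + 1) ≤ C₁ * ((C₁ + 1) * (K + 1)) := by
    have h21 : C * (C₁ + K + 1) ≤ C₁ * (C₁ + K + 1) :=
      mul_le_mul_of_nonneg_right hCC₁ (by positivity)
    have h22 : C₁ + K + 1 ≤ (C₁ + 1) * (K + 1) := by nlinarith
    calc C * (C₁ + K + 1) ≤ C₁ * (C₁ + K + 1) := h21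
      _ ≤ C₁ * ((C₁ + 1) * (K + 1)) := by gcongr
  have h3 : 0 ≤ C₁ * ((C₁ + 1) * (K + 1)) := by positivity
  calc C * (C₁ + K + 1) ≤ C₁ * ((C₁ + 1) * (K + 1)) := h2
    _ = C₁ * ((C₁ + 1) * (K + 1)) * 1 := (mul_one _).symm
    _ ≤ C₁ * ((C₁ + 1) * (K + 1)) * (κ / ‖(fun j => (k j : ℝ))‖) := by gcongr
    _ = C₁ * (C₁ + 1) * κ * (K + 1) / ‖(fun j => (k j : ℝ))‖ := by ring

/-! ## §S STRENGTHEN — the more rigid forms considered (typed; none is claimed) -/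

/-- **S⁺1 = `C⁺(1)`**, the class-uniform bounded unit-range half (signature of the registered open stub
`stub_classUniformIR` of line `hardcore-monotone-class-uniformity`, verbatim). -/
def ClassUniformIROne : Prop :=
  ∀ κ : ℝ, 0 < κ → ∃ ρ₀ : ℝ, 0 < ρ₀ ∧ ∃ C : ℝ, 0 < C ∧ ∀ ρ : ℝ, 0 < ρ → ρ < ρ₀ →
    ∀ᶠ N : ℕ in atTop, ∃ δ : ℝ≥0∞, 0 < δ ∧
      ∀ w : ℝ → ℝ≥0∞, IsRepulsiveFiniteRange w → (∀ r, 1 < r → w r = 0) →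
        (∃ M : ℝ≥0∞, M ≠ ⊤ ∧ ∀ r, w r ≤ M) →
        ∀ Ψ : PeriodicTrialState N (sideLength ρ N), NearMin w ρ N δ Ψ →
          ∀ k : Fin 3 → ℤ, InWindow κ ρ N k → IRIneq C ρ N Ψ.ψ k

/-- S⁺1 gives the crux (landed p136757) … -/
theorem periodicIRBound_of_classUniform (h : ClassUniformIROne) : PeriodicIRBound :=
  periodicIRBound_iff.2 (stub_reductionToClassUniformOne h)

/-- … and its floor is torus TL-BEC for EVERY admissible potential (landed p136757 ∘ p99222). -/
theorem floor_classUniform (h : ClassUniformIROne) :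
    ∀ v : ℝ → ℝ≥0∞, IsRepulsiveFiniteRange v → PeriodicBECFor v :=
  fun v hv => stub_floorOfClassUniformOne h v hv

/-- **S⁺2 (typed): the all-box form** — the bound on tori of EVERY side `L` at density `≤ ρ₀` (the quantifier shape of
`GaussianDomination`, stmt-12620), eventually in `N`; the crux is its diagonal `L = L_N`. -/
def AllBoxIRBound : Prop :=
  ∀ v : ℝ → ℝ≥0∞, IsRepulsiveFiniteRange v → ∀ κ : ℝ, 0 < κ → ∃ ρ₀ : ℝ, 0 < ρ₀ ∧ ∃ C : ℝ, 0 < C ∧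
    ∀ᶠ N : ℕ in atTop, ∀ L : ℝ, 0 < L → (N : ℝ) ≤ ρ₀ * L ^ 3 → ∃ δ : ℝ≥0∞, 0 < δ ∧
      ∀ Ψ : PeriodicTrialState N L, periodicEnergy v Ψ ≤ periodicGroundStateEnergy v N L + δ →
        ∀ k : Fin 3 → ℤ, k ≠ 0 → ‖(fun j => (k j : ℝ))‖ ≤ κ * Real.sqrt ((N : ℝ) / L ^ 3) * L →
          cellOccupation N L (planeWaveMode L k) Ψ.ψ ≤
            ENNReal.ofReal (C * Real.sqrt ((N : ℝ) / L ^ 3) * L / ‖(fun j => (k j : ℝ))‖)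

/-- **S⁺3 (typed): the particle-increment (induction-in-`N`) form** at fixed box side, on the ground-state
occupations `γ_N(k)` of Disproof §11: the bound at `N` propagates to `N + 1` with a summable loss. -/
def ParticleIncrementIR (v : ℝ → ℝ≥0∞) : Prop :=
  ∀ κ : ℝ, 0 < κ → ∃ ρ₀ : ℝ, 0 < ρ₀ ∧ ∃ C : ℝ, 0 < C ∧ ∃ ε : ℕ → ℝ, (∀ n, 0 ≤ ε n) ∧ Summable ε ∧
    ∀ ρ : ℝ, 0 < ρ → ρ < ρ₀ → ∀ᶠ N : ℕ in atTop, ∀ k : Fin 3 → ℤ, InWindow κ ρ N k →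
      groundOccupation v N (sideLength ρ N) k ≤
          ENNReal.ofReal (C * Real.sqrt ρ * sideLength ρ N / ‖(fun j => (k j : ℝ))‖) →
      groundOccupation v (N + 1) (sideLength ρ N) k ≤
          ENNReal.ofReal (C * (1 + ε N) * Real.sqrt ρ * sideLength ρ N / ‖(fun j => (k j : ℝ))‖)

/-! ## §D DECOMPOSITION — the typed splits, their landed glue, and their floors -/

/-- The integrable (soft) half of the crux. -/
def IntegrableHalf : Prop :=
  ∀ v : ℝ → ℝ≥0∞, IsRepulsiveFiniteRange v → (∫⁻ x : Space, v ‖x‖) ≠ ⊤ → IRBoundFor v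

/-- **D1 glue** (landed `Negative.periodicIRBound_iff_split`, p75776): soft half + hard-core half ⇒ crux … -/
theorem periodicIRBound_of_halves (h₁ : IntegrableHalf) (h₂ : NonIntegrableHalf) : PeriodicIRBound :=
  periodicIRBound_iff_split.2 ⟨h₁, h₂⟩

/-- … and conversely (it is a partition, not a weakening). -/
theorem halves_of_periodicIRBound (h : PeriodicIRBound) : IntegrableHalf ∧ NonIntegrableHalf :=
  periodicIRBound_iff_split.1 h

/-- **D2 glue** (landed `TwoSectorGdTransfer.stub_periodicIRBoundOfPooled`, lead c11, 2026-08-17): two-sector Gaussian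
domination (stmt-12620) + midpoint near-convexity (stmt-9094) + the hard-core half ⇒ crux by name. -/
theorem periodicIRBound_of_pooled (h₁ : GaussianDomination) (h₂ : EnergyConvexityWindow) (h₆ : NonIntegrableHalf) :
    PeriodicIRBound :=
  periodicIRBound_iff.2 (stub_periodicIRBoundOfPooled h₁ h₂ h₆)

/-- **Floor of D1's soft piece**: it alone proves torus TL-BEC for every soft admissible potential (p99222). -/
theorem floor_integrableHalf (h : IntegrableHalf) :
    ∀ v : ℝ → ℝ≥0∞, IsRepulsiveFiniteRange v → (∫⁻ x : Space, v ‖x‖) ≠ ⊤ → PeriodicBECFor v :=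
  fun v hv hint => periodicBEC_of_irBoundFor v hv (h v hv hint)

/-- **Floor of D2's imported pieces**: 12620 ∧ 9094 prove torus TL-BEC for every soft admissible potential. -/
theorem floor_pooled (h₁ : GaussianDomination) (h₂ : EnergyConvexityWindow) :
    ∀ v : ℝ → ℝ≥0∞, IsRepulsiveFiniteRange v → (∫⁻ x : Space, v ‖x‖) ≠ ⊤ → PeriodicBECFor v :=
  fun v hv hint => periodicBEC_of_irBoundFor v hv (stub_integrableHalfOfPooled h₁ h₂ v hv hint)

/-- **Floor of the hard-core piece**: it alone proves torus TL-BEC for every NON-integrable admissible potential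
(hard spheres included). -/
theorem floor_nonIntegrableHalf (h : NonIntegrableHalf) :
    ∀ v : ℝ → ℝ≥0∞, IsRepulsiveFiniteRange v → (∫⁻ x : Space, v ‖x‖) = ⊤ → PeriodicBECFor v :=
  fun v hv htop => periodicBEC_of_irBoundFor v hv (h v hv htop)

/-! ## §N NEGATION — normal form of a counterexample -/

/-- A counterexample is ONE admissible potential violating `IRBoundFor` (Disproof §1/§21: WLOG `0 < a(v)`, unit range). -/
theorem not_periodicIRBound_iff : ¬ PeriodicIRBound ↔ ∃ v : ℝ → ℝ≥0∞, IsRepulsiveFiniteRange v ∧ ¬ IRBoundFor v := by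
  rw [periodicIRBound_iff]
  push_neg
  rfl

end Summit.AtomisticToContinuum.BoseEinsteinCondensation.Cruxes.PeriodicIRBound.Strategist

end
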